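import Summits.HubbardSuperconductivity.HubbardSuperconductivity.Theorems.AnisotropyChordTransferFibre3N1RowExpr

/-!
# Route `AnisotropyChord` / H0 rotor rung, LEVEL 2 row `N₁`: the `RExpr` transcription, part 2 — the objects `B` and `A(x̂)`

Continuation of `…Fibre3N1RowExpr` (blueprint HOME/hubbard-h0-rotor-p2/level2_N1_hat.py, design memo LEVEL2-EVAL-DESIGN-g4.md).
Hatted objects (`t = θ²`): `B̂ = t³·Σ_k F₂(k)²F₂(k + K₁)` (`B = 6B̂/(4π²t²)`) and `Â = t²·Σ_k F₂(k)² cos kₓ` (`A(x̂) = Â/(4π²t)`),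
each as a two-sided `RExpr` bracket over the Level-2 variable vector + block unknowns:
* `B2lo/B2hi M₂`: special points `k = 0, −K₁` (`F̂(0)²F̂(K₁) + F̂(−K₁)²F̂(0)`), pair block `blockP M₂ = {−M₂−1 ≤ q₁ ≤ M₂, |q₂| ≤ M₂} ∖ {0, −K₁}`
  termwise (`F̂(q)²F̂(q + x̂)`), closed outer part = `BClosedExpansion` hatted (`BclosedFull`) minus the block part, outer tail =
  `BOuterBound` hatted and reduced to `Ĝ21, T̂10, Ŝ₁, Ŝ₂, ĝ₁` (`BtailFull`) minus the block part, clipped at `0`;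
* `A2lo/A2hi M₂`: `F̂(0)²` + block `F̂(q)²·cos(q₁θ)` with the cosine unknowns `vCos m ∈ [1 − m²t/2, 1 − m²t/2 + m⁴t²/24]` (indices after
  the `t̂` block), closed outer part `4c_s²Ĉ₂ + 4c_s a²t Ĉ₁ − a⁴t²` (`AxClosedExpansion` + `CosWeightedReduction` hatted:
  `Ĉ₂ = (1 − νt/4)Ŝ₂ − tŜ₁/4`, `Ĉ₁ = (1 − νt/4)Ŝ₁ − (4π² − t)/4`) minus the block part, tail `2κ|c|̂ĝ + κ²ĝ²` (`AxOuterBound`).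
Computable only; soundness in `…N1RowExprSound` (hypotheses PartN41-B §2/§5/§6).
Prover seat `hubbard-h0-rotor-p2` g4; helper for piece A = stmt-HubbardSuperconductivity-23918 of rung 19089
(`--supports`, helper class).  Nothing here proves superconductivity in the Hubbard model; computable helper definitions of ONE
conditional reduction (the GM₃ ∀L certificate, Level-2 row `N₁`); the rotor TARGET as originally worded stays FALSE (g15 verdict).
Mathlib + the tree only; no sorry.
-/

set_option linter.dupNamespace false
set_option autoImplicit false

open Literature.Analysis.ValidatedNumerics

namespace Summit.HubbardSuperconductivity.HubbardSuperconductivity.Theorems.AnisotropyChord.Transfer.Fibre3.L2.N1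

/-! ## The object `B̂ = t³·Σ_k F₂(k)² F₂(k + K₁)` -/

/-- the pair block `{−M₂−1 ≤ q₁ ≤ M₂, |q₂| ≤ M₂} ∖ {(0,0), (−1,0)}`. -/
def blockP (M2 : ℕ) : List (ℤ × ℤ) :=
  ((List.range (2 * M2 + 2)).flatMap fun i => (List.range (2 * M2 + 1)).map fun j =>
    (((i : ℤ) - M2 - 1), ((j : ℤ) - M2))).filter fun q => q ≠ (0, 0) ∧ q ≠ (-1, 0)

/-- `ĝ₁ = ĝ(K₁)`. -/
def g1h (M : ℕ) : RExpr := vG M (1, 0)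
/-- `D = a²t` (the hatted constant part of `−c`). -/
def Dt : RExpr := .mul dd vT
/-- `Ŝ₁ − ĝ₁` (`t·Σ_{T′} g`). -/
def Sg1 (M : ℕ) : RExpr := .sub S1h (g1h M)
/-- `Ŝ₂ − ĝ₁²` (`t²·Σ_{T′} g²`). -/
def Sg2 (M : ℕ) : RExpr := .sub vS2 (.sq (g1h M))
/-- `Ĝ21`. -/
def vG21 : RExpr := .var 9

/-- `BClosedExpansion` hatted: `t³Σ_{T′} c²c′ = −[8c_s³Ĝ21 + 4c_s²D(Ŝ₂ − ĝ₁²) + 8c_s²D T̂10 + 6c_sD²(Ŝ₁ − ĝ₁) + D²·a²t(4π² − 2t)]`. -/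
def BclosedFull (M : ℕ) : RExpr :=
  .neg (rsum [ .mul (.mul (cst 8) (cube cs)) vG21,
    .mul (.mul (.mul (cst 4) (.sq cs)) Dt) (Sg2 M),
    .mul (.mul (.mul (cst 8) (.sq cs)) Dt) vT10,
    .mul (.mul (.mul (cst 6) cs) (.sq Dt)) (Sg1 M),
    .mul (.mul (.sq Dt) (.mul dd vT)) (.sub (.mul (cst 4) vPi2) (.mul (cst 2) vT)) ])

/-- `BOuterBound` majorant hatted and summed over `T′`:
`2κ[4c_s²Ĝ21 + 2c_sD(Ŝ₂−ĝ₁²) + 2c_sD T̂10 + D²(Ŝ₁−ĝ₁)] + κ[4c_s²Ĝ21 + 4c_sD T̂10 + D²(Ŝ₁−ĝ₁)]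
 + κ²[2c_sĜ21 + D(Ŝ₂−ĝ₁²) + 2(2c_sĜ21 + D T̂10)] + κ³Ĝ21`. -/
def BtailFull (M : ℕ) : RExpr :=
  rsum [ .mul (.mul (cst 2) kap) (rsum [ .mul (.mul (cst 4) (.sq cs)) vG21, .mul (.mul (.mul (cst 2) cs) Dt) (Sg2 M),
      .mul (.mul (.mul (cst 2) cs) Dt) vT10, .mul (.sq Dt) (Sg1 M) ]),
    .mul kap (rsum [ .mul (.mul (cst 4) (.sq cs)) vG21, .mul (.mul (.mul (cst 4) cs) Dt) vT10, .mul (.sq Dt) (Sg1 M) ]),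
    .mul (.sq kap) (rsum [ .mul (.mul (cst 2) cs) vG21, .mul Dt (Sg2 M),
      .mul (cst 2) (.add (.mul (.mul (cst 2) cs) vG21) (.mul Dt vT10)) ]),
    .mul (cube kap) vG21 ]

/-- the per-momentum `B` tail majorant `2κ|c|̂|c′|̂ĝ + κ|c|̂²ĝ′ + κ²(ĝ²|c′|̂ + 2|c|̂ĝĝ′) + κ³ĝ²ĝ′` (`q′ = q + x̂`). -/
def BtailAt (M : ℕ) (q : ℤ × ℤ) : RExpr :=
  let q' : ℤ × ℤ := (q.1 + 1, q.2)
  rsum [ .mul (.mul (.mul (.mul (cst 2) kap) (ach M q)) (ach M q')) (vG M q),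
    .mul (.mul kap (.sq (ach M q))) (vG M q'),
    .mul (.sq kap) (.add (.mul (.sq (vG M q)) (ach M q')) (.mul (.mul (.mul (cst 2) (ach M q)) (vG M q)) (vG M q'))),
    .mul (cube kap) (.mul (.sq (vG M q)) (vG M q')) ]

/-- the common part of the `B̂` bracket: special points + block + closed outer. -/
def B2core (M2 : ℕ) : RExpr :=
  let M := M2 + 1
  rsum [ .mul (.sq F0h) (Fh M (1, 0)), .mul (.sq (Fh M (-1, 0))) F0h,
    rsum ((blockP M2).map fun q => .mul (.sq (Fh M q)) (Fh M (q.1 + 1, q.2))),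
    BclosedFull M,
    .neg (rsum ((blockP M2).map fun q => .mul (.sq (ch M q)) (ch M (q.1 + 1, q.2)))) ]
/-- the clipped outer tail of `B̂`. -/
def B2tail (M2 : ℕ) : RExpr :=
  let M := M2 + 1
  .max (.sub (BtailFull M) (rsum ((blockP M2).map fun q => BtailAt M q))) (cst 0)
/-- ★ upper hatted bracket of `B̂`. -/
def B2hi (M2 : ℕ) : RExpr := .add (B2core M2) (B2tail M2)
/-- ★ lower hatted bracket of `B̂`. -/
def B2lo (M2 : ℕ) : RExpr := .sub (B2core M2) (B2tail M2)

/-! ## The object `Â = t²·Σ_k F₂(k)² cos kₓ` -/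

/-- the cosine unknown `cos(mθ)`, `1 ≤ m ≤ M`, boxed in `[1 − m²t/2, 1 − m²t/2 + m⁴t²/24]` (indices after the `t̂` block). -/
def vCos (M : ℕ) (m : ℕ) : RExpr := .var (19 + 2 * (gridPts M).length + (m - 1))
/-- `cos(q₁θ)` as a term: `1` for `q₁ = 0`, else the unknown of `|q₁|`. -/
def cosq (M : ℕ) (q : ℤ × ℤ) : RExpr := if q.1 = 0 then cst 1 else vCos M q.1.natAbs
/-- `Ĉ₁ = t·Σ_{k≠0} g cos kₓ = (1 − νt/4)Ŝ₁ − (4π² − t)/4`. -/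
def C1h : RExpr := .sub (.mul (.sub (cst 1) (.mul (.mul vNu vT) (cst (1/4)))) S1h) (.mul (.sub (.mul (cst 4) vPi2) vT) (cst (1/4)))
/-- `Ĉ₂ = t²·Σ_{k≠0} g² cos kₓ = (1 − νt/4)Ŝ₂ − tŜ₁/4`. -/
def C2h : RExpr := .sub (.mul (.sub (cst 1) (.mul (.mul vNu vT) (cst (1/4)))) vS2) (.mul (.mul vT S1h) (cst (1/4)))
/-- `AxClosedExpansion` hatted: `t²Σ_{k≠0} c² cos kₓ = 4c_s²Ĉ₂ + 4c_sD Ĉ₁ − D²`. -/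
def AclosedFull : RExpr := .sub (.add (.mul (.mul (cst 4) (.sq cs)) C2h) (.mul (.mul (.mul (cst 4) cs) Dt) C1h)) (.sq Dt)
/-- `AxOuterBound` majorant summed over `k ≠ 0`: `2κ(2c_sŜ₂ + DŜ₁) + κ²Ŝ₂`. -/
def AtailFull : RExpr :=
  .add (.mul (.mul (cst 2) kap) (.add (.mul (.mul (cst 2) cs) vS2) (.mul Dt S1h))) (.mul (.sq kap) vS2)
/-- per-momentum `A` tail `2κ|c|̂ĝ + κ²ĝ²`. -/
def AtailAt (M : ℕ) (q : ℤ × ℤ) : RExpr :=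
  .add (.mul (.mul (.mul (cst 2) kap) (ach M q)) (vG M q)) (.mul (.sq kap) (.sq (vG M q)))
/-- the common part of the `Â` bracket. -/
def A2core (M2 : ℕ) : RExpr :=
  let M := M2 + 1
  rsum [ .sq F0h, rsum ((block1 M2).map fun q => .mul (.sq (Fh M q)) (cosq M q)), AclosedFull,
    .neg (rsum ((block1 M2).map fun q => .mul (.sq (ch M q)) (cosq M q))) ]
/-- the clipped outer tail of `Â`. -/
def A2tail (M2 : ℕ) : RExpr :=
  let M := M2 + 1
  .max (.sub AtailFull (rsum ((block1 M2).map fun q => AtailAt M q))) (cst 0)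
/-- ★ upper hatted bracket of `Â`. -/
def A2hi (M2 : ℕ) : RExpr := .add (A2core M2) (A2tail M2)
/-- ★ lower hatted bracket of `Â`. -/
def A2lo (M2 : ℕ) : RExpr := .sub (A2core M2) (A2tail M2)

end Summit.HubbardSuperconductivity.HubbardSuperconductivity.Theorems.AnisotropyChord.Transfer.Fibre3.L2.N1
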